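import Summits.SmoothPoincare4.SmoothPoincare4.Theorems.CongruenceShadowsAgkCor6SufficiencyStubFillingUniqueness
import Literature.Topology.FourManifolds.RegularLevelSplitting
import Literature.Topology.FourManifolds.SPC4HandlesTwoHandlebodyGenusCount
import Literature.Topology.FourManifolds.SPC4HandlesTwoHandlebodyProofs
import Literature.Topology.FourManifolds.SPC4OneHandlebodyBoundaryProofs
import Literature.Topology.FourManifolds.CorkDecomposition
import Literature.Topology.FourManifolds.GluingProofs
import Literature.Topology.FourManifolds.HandlesProofs
import Literature.Topology.FourManifolds.TripleDisjointUnion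

/-!
# Stub `stub_coredReassembly` of line `lp-by-sphere-system-surgery` for crux `AgkCor6Sufficiency`
(item stmt-SmoothPoincare4-10894; routes `CongruenceShadows` / `GroupTrisection`, crux
`Summit.SmoothPoincare4.SmoothPoincare4.Theses.CongruenceShadows.AgkCor6Sufficiency`,
Abrams–Gay–Kirby Cor. 6 ⇐; checked skeleton
`Cruxes/AgkCor6Sufficiency/Lines/lp-by-sphere-system-surgery.lean`, lead reshape r3)

**Cored reassembly** — the LP/gluing half of the Abrams–Gay–Kirby Thm 5 assembly (A. Abrams,
D. Gay, R. Kirby, *Group trisections and smooth 4-manifolds*, Geom. Topol. 22 (2018), proof of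
Thm. 5, pp. 1541–1542), isolated from the spine: if two
closed oriented smooth `4`-manifolds `X`, `X'` carry smooth functions `f`, `f'` with regular level
`1/2` whose superlevel sets are diffeomorphic to disjoint unions `V 0 ⊔ V 1 ⊔ V 2`,
`V' 0 ⊔ V' 1 ⊔ V' 2` of three compact connected orientable `1`-handlebodies and whose sublevel
sets are diffeomorphic (`Θ`), then `X ≅ X'` — GIVEN the line's statement `FillingUniqueness`
(every diffeomorphism between the boundaries of two compact connected orientable `4`-dimensional
`1`-handlebodies extends; Meier–Scott 2025, Thm. 4.1(2) / Prop. 4.8(2); registered as the separate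
stub `stub_fillingUniqueness`, imported from its landed module and taken here as the antecedent).
This is the three-component version of the landed one-component reassembly
`…Theorems.CongruenceShadowsAgkCor6SufficiencyStubTwoHandlebodyReassembly` (Matsumoto, *An
Introduction to Morse Theory* (2001), §5.3, Lemma 5.20; Kirby, *The topology of 4-manifolds*
(1989), Ch. I §2, p. 8).

Proof (pure glue over the tree and Mathlib's disjoint-union manifolds, no new geometry):
* `X = {f ≤ 1/2} ∪_φ {f ≥ 1/2}` along the level (`RegularSublevel.isBoundaryGluing_split`,
  `RegularLevelSplitting.lean`), and likewise `X'`; the gluing of `X'` is moved along `Θ`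
  (`IsBoundaryGluing.transfer`, `CorkDecomposition.lean`), so that `X` and `X'` are glued from the
  SAME piece `W = {f ≤ 1/2}` with seams `φ`, `φ''` into the superlevel sets `N`, `N'`;
* it remains to find ONE diffeomorphism `Ψ : N ≅ N'` with `∂Ψ ∘ φ = φ''`, for then `X'` is also
  `W ∪_φ N` (`IsBoundaryGluing.of_diffeomorph_right`, `SPC4HandlesTwoHandlebodyProofs.lean`) and
  `X ≅ X'` by uniqueness of gluings (`nonempty_diffeomorph_of_isBoundaryGluing_holds`,
  `GluingProofs.lean`; Hirsch, *Differential Topology* (1976), Ch. 8 §2, Thm. 2.1);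
* `Ψ` — **filling uniqueness for triple disjoint unions** (`triSum_filling`,
  `filling_of_diffeomorph_triSum`), over the tree's triple-disjoint-union plumbing
  `Literature/Topology/FourManifolds/TripleDisjointUnion.lean` (`TriSum V = V 0 ⊕ (V 1 ⊕ V 2)`):
  transport to the sums along `∂e`, `∂e'` (`BoundaryData.restrictDiffeomorph`); the boundary of
  `V 0 ⊔ V 1 ⊔ V 2` is the disjoint union of the boundaries (`TriSum.boundaryData`); each `∂(V i)`
  is connected (`connectedSpace_boundary_of_isHandlebodyOfIndexLE_one_holds`, Kirby 1989, Ch. I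
  §2), so a diffeomorphism of the boundaries carries `∂(V i)` onto `∂(V' (σ i))` for a permutation
  `σ` (`TriSum.exists_perm`) with smooth components (`TriSum.comp`); the components extend over the
  handlebodies by `FillingUniqueness`, and the three extensions glue to a diffeomorphism of the
  sums (`TriSum.glue`).

This file declares the registered statement `CoredReassembly` (verbatim from the skeleton) and
proves the registered stub `stub_coredReassembly : FillingUniqueness → CoredReassembly`.
No `sorry`, no new named fact.
-/

noncomputable section

-- the prescribed namespace `Summit.<P>.<Sub>.…` duplicates `SmoothPoincare4` (P = Sub)
set_option linter.dupNamespace false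

open Set Function
open scoped Manifold ContDiff Topology

namespace Summit.SmoothPoincare4.SmoothPoincare4.Cruxes.AgkCor6Sufficiency.LpBySphereSystemSurgery

open Literature.Topology.FourManifolds

/-! ### Filling uniqueness for triple disjoint unions of `1`-handlebodies -/

section Filling

variable (V V' : Fin 3 → Type) [∀ i, TopologicalSpace (V i)] [∀ i, T2Space (V i)]
    [∀ i, SecondCountableTopology (V i)] [∀ i, CompactSpace (V i)] [∀ i, ConnectedSpace (V i)]
    [∀ i, ChartedSpace (EuclideanHalfSpace 4) (V i)] [∀ i, IsManifold (𝓡∂ 4) ∞ (V i)]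
    [∀ i, TopologicalSpace (V' i)] [∀ i, T2Space (V' i)]
    [∀ i, SecondCountableTopology (V' i)] [∀ i, CompactSpace (V' i)] [∀ i, ConnectedSpace (V' i)]
    [∀ i, ChartedSpace (EuclideanHalfSpace 4) (V' i)] [∀ i, IsManifold (𝓡∂ 4) ∞ (V' i)]

/-- **Filling uniqueness for triple disjoint unions of compact connected orientable
`1`-handlebodies** (granted `FillingUniqueness` for the connected ones): every diffeomorphism
`χ : ∂V 0 ⊔ ∂V 1 ⊔ ∂V 2 ≅ ∂V' 0 ⊔ ∂V' 1 ⊔ ∂V' 2` extends to a diffeomorphism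
`V 0 ⊔ V 1 ⊔ V 2 ≅ V' 0 ⊔ V' 1 ⊔ V' 2` (with respect to the assembled boundary data
`TriSum.boundaryData`).  The boundaries `∂V i` are connected
(`connectedSpace_boundary_of_isHandlebodyOfIndexLE_one_holds`; Kirby 1989, Ch. I §2, p. 8), so `χ`
carries `∂V i` onto `∂V' (σ i)` for a permutation `σ` (`TriSum.exists_perm`, `TriSum.comp`); the
components extend by `FillingUniqueness`, and the extensions glue (`TriSum.glue`). -/
theorem triSum_filling (hFU : FillingUniqueness)
    (hV : ∀ i, IsHandlebodyOfIndexLE 3 1 (V i)) (hoV : ∀ i, IsOrientable (𝓡∂ 4) (V i))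
    (hV' : ∀ i, IsHandlebodyOfIndexLE 3 1 (V' i)) (hoV' : ∀ i, IsOrientable (𝓡∂ 4) (V' i))
    (b : ∀ i, BoundaryData (𝓡∂ 4) (V i) (𝓡 3)) (b' : ∀ i, BoundaryData (𝓡∂ 4) (V' i) (𝓡 3))
    (χ : TriSum (fun i => (b i).carrier) ≃ₘ⟮𝓡 3, 𝓡 3⟯ TriSum (fun i => (b' i).carrier)) :
    ∃ Ψ : TriSum V ≃ₘ⟮𝓡∂ 4, 𝓡∂ 4⟯ TriSum V',
      ⇑Ψ ∘ (TriSum.boundaryData V b).incl = (TriSum.boundaryData V' b').incl ∘ ⇑χ := by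
  haveI : ∀ i, ConnectedSpace (b i).carrier := fun i =>
    connectedSpace_boundary_of_isHandlebodyOfIndexLE_one_holds (V i) (hV i) (hoV i) (b i)
  haveI : ∀ i, ConnectedSpace (b' i).carrier := fun i =>
    connectedSpace_boundary_of_isHandlebodyOfIndexLE_one_holds (V' i) (hV' i) (hoV' i) (b' i)
  obtain ⟨σ, hσ⟩ := TriSum.exists_perm (W := fun i => (b i).carrier) (fun i => (b' i).carrier)
    χ.toHomeomorph
  replace hσ : ∀ i w, TriSum.idx (fun i => (b' i).carrier)
      (χ (TriSum.inj (fun i => (b i).carrier) i w)) = σ i := hσ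
  have hex : ∀ i, ∃ Ψ : V i ≃ₘ⟮𝓡∂ 4, 𝓡∂ 4⟯ V' (σ i),
      ⇑Ψ ∘ (b i).incl = (b' (σ i)).incl ∘ ⇑(TriSum.comp χ σ hσ i) := fun i =>
    hFU (V i) (V' (σ i)) (hV i) (hV' (σ i)) (hoV i) (hoV' (σ i)) (b i) (b' (σ i))
      (TriSum.comp χ σ hσ i)
  choose Ψ hΨ using hex
  refine ⟨TriSum.glue σ Ψ, funext fun z => ?_⟩
  obtain ⟨i, zi, rfl⟩ := TriSum.exists_eq_inj' (fun i => (b i).carrier) z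
  have h1 : Ψ i ((b i).incl zi) = (b' (σ i)).incl (TriSum.comp χ σ hσ i zi) := congrFun (hΨ i) zi
  rw [comp_apply, comp_apply, TriSum.boundaryData_incl_inj, TriSum.glue_inj, h1,
    ← TriSum.boundaryData_incl_inj V' b', TriSum.inj_comp_apply]

/-- **Filling uniqueness for manifolds diffeomorphic to triple disjoint unions of compact
connected orientable `1`-handlebodies**, for arbitrary boundary data `bN`, `bN'`: every
diffeomorphism `χ : ∂N ≅ ∂N'` extends to `N ≅ N'`.  Transport along the restrictions `∂e`,
`∂e'` (`BoundaryData.restrictDiffeomorph`, `CorkDecomposition.lean`) of the given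
diffeomorphisms `e`, `e'` to the boundary data `TriSum.boundaryData` assembled from the canonical
boundary data `BoundaryManifold.boundaryData 3 (V i)` (`Cobordism.lean`) of the summands, and
apply `triSum_filling`. -/
theorem filling_of_diffeomorph_triSum (hFU : FillingUniqueness)
    (hV : ∀ i, IsHandlebodyOfIndexLE 3 1 (V i)) (hoV : ∀ i, IsOrientable (𝓡∂ 4) (V i))
    (hV' : ∀ i, IsHandlebodyOfIndexLE 3 1 (V' i)) (hoV' : ∀ i, IsOrientable (𝓡∂ 4) (V' i))
    {N N' : Type} [TopologicalSpace N] [ChartedSpace (EuclideanHalfSpace 4) N]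
    [IsManifold (𝓡∂ 4) ∞ N] [TopologicalSpace N'] [ChartedSpace (EuclideanHalfSpace 4) N']
    [IsManifold (𝓡∂ 4) ∞ N']
    (bN : BoundaryData (𝓡∂ 4) N (𝓡 3)) (bN' : BoundaryData (𝓡∂ 4) N' (𝓡 3))
    (e : N ≃ₘ⟮𝓡∂ 4, 𝓡∂ 4⟯ TriSum V) (e' : N' ≃ₘ⟮𝓡∂ 4, 𝓡∂ 4⟯ TriSum V')
    (χ : bN.carrier ≃ₘ⟮𝓡 3, 𝓡 3⟯ bN'.carrier) :
    ∃ Ψ : N ≃ₘ⟮𝓡∂ 4, 𝓡∂ 4⟯ N', ⇑Ψ ∘ bN.incl = bN'.incl ∘ ⇑χ := by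
  let b : ∀ i, BoundaryData (𝓡∂ 4) (V i) (𝓡 3) := fun i => BoundaryManifold.boundaryData 3 (V i)
  let b' : ∀ i, BoundaryData (𝓡∂ 4) (V' i) (𝓡 3) := fun i =>
    BoundaryManifold.boundaryData 3 (V' i)
  -- the restrictions `∂e`, `∂e'` to the boundary data, with their defining equations
  obtain ⟨r, hr⟩ : ∃ r : bN.carrier ≃ₘ⟮𝓡 3, 𝓡 3⟯ TriSum (fun i => (b i).carrier),
      ∀ z, (TriSum.boundaryData V b).incl (r z) = e (bN.incl z) :=
    ⟨bN.restrictDiffeomorph (TriSum.boundaryData V b) e,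
      fun z => BoundaryData.incl_restrictDiffeomorph e z⟩
  obtain ⟨r', hr'⟩ : ∃ r' : bN'.carrier ≃ₘ⟮𝓡 3, 𝓡 3⟯ TriSum (fun i => (b' i).carrier),
      ∀ z, (TriSum.boundaryData V' b').incl (r' z) = e' (bN'.incl z) :=
    ⟨bN'.restrictDiffeomorph (TriSum.boundaryData V' b') e',
      fun z => BoundaryData.incl_restrictDiffeomorph e' z⟩
  obtain ⟨Φ, hΦ⟩ := triSum_filling V V' hFU hV hoV hV' hoV' b b' ((r.symm.trans χ).trans r')
  refine ⟨(e.trans Φ).trans e'.symm, funext fun z => ?_⟩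
  have h2 := congrFun hΦ (r z)
  rw [comp_apply, comp_apply, Diffeomorph.coe_trans, Diffeomorph.coe_trans, comp_apply,
    comp_apply, Diffeomorph.symm_apply_apply, hr, hr'] at h2
  rw [comp_apply, comp_apply, Diffeomorph.coe_trans, Diffeomorph.coe_trans, comp_apply,
    comp_apply, h2, Diffeomorph.symm_apply_apply]

end Filling

/-! ### The statement of the stub -/

/-- **Cored reassembly** (lead reshape r3; the LP/gluing half of the AGK Thm 5 assembly,
isolated from the spine): let `X`, `X'` be closed oriented smooth `4`-manifolds carrying smooth
functions `f`, `f'` with regular level `1/2` whose SUPERLEVEL sets `{f ≥ 1/2}`, `{f' ≥ 1/2}` are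
each diffeomorphic to a disjoint union of three compact connected orientable `1`-handlebodies
(the cores of the three sectors), and whose SUBLEVEL sets (the spine neighbourhoods) are
diffeomorphic.  Then `X ≅ X'`: `X = {f ≤ 1/2} ∪ {f ≥ 1/2}` along the regular level
(`RegularSublevel.isBoundaryGluing_split`), transport the gluing of `X'` along the given
diffeomorphism of sublevel sets (`IsBoundaryGluing.transfer`), and extend the resulting
identification of the boundaries of the superlevel sets over them summand by summand by filling
uniqueness (`FillingUniqueness`, a hypothesis of the registered stub) — the three-component
version of the landed `stub_twoHandlebodyReassembly` / Matsumoto's Lemma 5.20. -/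
def CoredReassembly : Prop :=
  ∀ (X : Type) [TopologicalSpace X] [T2Space X] [SecondCountableTopology X]
    [ChartedSpace (EuclideanSpace ℝ (Fin 4)) X] [IsManifold (𝓡 4) ∞ X] [CompactSpace X]
    (_ : SmoothOrientation (𝓡 4) X)
    (X' : Type) [TopologicalSpace X'] [T2Space X'] [SecondCountableTopology X']
    [ChartedSpace (EuclideanSpace ℝ (Fin 4)) X'] [IsManifold (𝓡 4) ∞ X'] [CompactSpace X']
    (_ : SmoothOrientation (𝓡 4) X')
    (f : X → ℝ) (f' : X' → ℝ) (hf : IsRegularLevel (𝓡 4) f (1 / 2))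
    (hf' : IsRegularLevel (𝓡 4) f' (1 / 2))
    (V : Fin 3 → Type) (_ : ∀ i, TopologicalSpace (V i)) (_ : ∀ i, T2Space (V i))
    (_ : ∀ i, SecondCountableTopology (V i)) (_ : ∀ i, CompactSpace (V i))
    (_ : ∀ i, ConnectedSpace (V i)) (_ : ∀ i, ChartedSpace (EuclideanHalfSpace 4) (V i))
    (_ : ∀ i, IsManifold (𝓡∂ 4) ∞ (V i))
    (_ : ∀ i, IsHandlebodyOfIndexLE 3 1 (V i)) (_ : ∀ i, IsOrientable (𝓡∂ 4) (V i))
    (V' : Fin 3 → Type) (_ : ∀ i, TopologicalSpace (V' i)) (_ : ∀ i, T2Space (V' i))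
    (_ : ∀ i, SecondCountableTopology (V' i)) (_ : ∀ i, CompactSpace (V' i))
    (_ : ∀ i, ConnectedSpace (V' i)) (_ : ∀ i, ChartedSpace (EuclideanHalfSpace 4) (V' i))
    (_ : ∀ i, IsManifold (𝓡∂ 4) ∞ (V' i))
    (_ : ∀ i, IsHandlebodyOfIndexLE 3 1 (V' i)) (_ : ∀ i, IsOrientable (𝓡∂ 4) (V' i))
    (_ : RegularSuperlevel hf ≃ₘ⟮𝓡∂ 4, 𝓡∂ 4⟯ (V 0 ⊕ (V 1 ⊕ V 2)))
    (_ : RegularSuperlevel hf' ≃ₘ⟮𝓡∂ 4, 𝓡∂ 4⟯ (V' 0 ⊕ (V' 1 ⊕ V' 2)))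
    (_ : RegularSublevel hf ≃ₘ⟮𝓡∂ 4, 𝓡∂ 4⟯ RegularSublevel hf'),
    Nonempty (X ≃ₘ⟮𝓡 4, 𝓡 4⟯ X')


/-! ### The stub -/

/-- **Stub `stub_coredReassembly`: cored reassembly from filling uniqueness** (the LP/gluing
half of the Abrams–Gay–Kirby Thm 5 assembly; three-component version of Matsumoto 2001,
Lemma 5.20 / Kirby 1989, Ch. I §2, p. 8).  `X = {f ≤ 1/2} ∪_φ {f ≥ 1/2}` along the regular level
(`RegularSublevel.isBoundaryGluing_split`); the gluing of `X'` is moved along the given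
diffeomorphism `Θ` of sublevel sets (`IsBoundaryGluing.transfer`), so that both `X` and `X'` are
glued from `W = {f ≤ 1/2}` with seams `φ`, `φ''`; the diffeomorphism `φ'' ∘ φ⁻¹` of the boundaries
of the superlevel sets extends to a diffeomorphism `Ψ` of the superlevel sets by filling
uniqueness for triple disjoint unions of `1`-handlebodies (`filling_of_diffeomorph_triSum`), so
`X'` is also `W ∪_φ {f ≥ 1/2}` (`IsBoundaryGluing.of_diffeomorph_right`) and `X ≅ X'` by
uniqueness of gluings (`nonempty_diffeomorph_of_isBoundaryGluing_holds`; Hirsch 1976, Ch. 8 §2,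
Thm. 2.1). -/
theorem stub_coredReassembly : FillingUniqueness → CoredReassembly := by
  intro hFU X _ _ _ _ _ _ _ X' _ _ _ _ _ _ _ f f' hf hf' V _ _ _ _ _ _ _ hV hVo V' _ _ _ _ _ _ _
    hV' hVo' eV eV' Θ
  -- `X' = {f ≤ 1/2} ∪_{φ''} {f' ≥ 1/2}`: the splitting of `X'` along its level, moved along `Θ`
  have hM'' : IsBoundaryGluing (RegularSublevel.boundaryData hf)
      (RegularSublevel.boundaryData hf'.const_sub)
      (((RegularSublevel.boundaryData hf).restrictDiffeomorph (RegularSublevel.boundaryData hf')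
        Θ).trans (RegularSublevel.splitDiffeomorph hf')) (𝓡 4) X' := by
    rw [Diffeomorph.coe_trans]
    exact (RegularSublevel.isBoundaryGluing_split hf').transfer Θ
  -- one diffeomorphism `Ψ` of the superlevel sets with `∂Ψ ∘ φ = φ''`
  obtain ⟨Ψ, hΨ⟩ := filling_of_diffeomorph_triSum V V' hFU hV hVo hV' hVo'
    (RegularSublevel.boundaryData hf.const_sub) (RegularSublevel.boundaryData hf'.const_sub) eV eV'
    ((RegularSublevel.splitDiffeomorph hf).symm.trans
      (((RegularSublevel.boundaryData hf).restrictDiffeomorph (RegularSublevel.boundaryData hf')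
        Θ).trans (RegularSublevel.splitDiffeomorph hf')))
  have hΘ : ∀ z, Ψ ((RegularSublevel.boundaryData hf.const_sub).incl
      (RegularSublevel.splitDiffeomorph hf z)) = (RegularSublevel.boundaryData hf'.const_sub).incl
      ((((RegularSublevel.boundaryData hf).restrictDiffeomorph (RegularSublevel.boundaryData hf')
        Θ).trans (RegularSublevel.splitDiffeomorph hf')) z) := by
    intro z
    have h1 : Ψ ((RegularSublevel.boundaryData hf.const_sub).incl
        (RegularSublevel.splitDiffeomorph hf z)) = (RegularSublevel.boundaryData hf'.const_sub).incl
        ((((RegularSublevel.boundaryData hf).restrictDiffeomorph (RegularSublevel.boundaryData hf')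
          Θ).trans (RegularSublevel.splitDiffeomorph hf'))
          ((RegularSublevel.splitDiffeomorph hf).symm (RegularSublevel.splitDiffeomorph hf z))) :=
      congrFun hΨ (RegularSublevel.splitDiffeomorph hf z)
    rw [Diffeomorph.symm_apply_apply] at h1
    exact h1
  -- `X = W ∪_φ N` and `X' = W ∪_φ N`, hence `X ≅ X'`
  exact nonempty_diffeomorph_of_isBoundaryGluing_holds (RegularSublevel.isBoundaryGluing_split hf)
    (hM''.of_diffeomorph_right Ψ hΘ)

end Summit.SmoothPoincare4.SmoothPoincare4.Cruxes.AgkCor6Sufficiency.LpBySphereSystemSurgery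

end
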